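/- Copyright: the b2b-balaban cell (near-miss cell 7), T⁴-continuum fan-out, ROUND-2 swarm `t4-ne7b-formalise-*`
(leaf 08), row NE7b (node U5c COUNT member).  Released under the licence of the surrounding project. -/
import Summits.QuantumFields.BalabanUV.T4Continuum.Support.HistoryRealisePrintTimed
import Summits.QuantumFields.BalabanUV.T4Continuum.Support.HistoryAssemblyRealiseRun

/-!
# Print-exact READING carriers: `RealisedReadingP` ∕ `RealisedReadingRP` and the LE term reading from them
(row S1b-P2 «print-exact carriers», part 2; repair route R-40-a of R-OWNER-40-2)

Summits-side support leaf of the T⁴-continuum cell (rung (B)+1 on a FINITE torus only; NOT infinite volume, NOT the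
mass gap, NOT the Clay statement; NOT a proof of the spine estimate NE7b, which is the cell's OWN estimate, NOT PRINTED
and NOT PROVED).  Row S1b-P2 of `t4/b2b-balaban-t4-ne7b-p1/LEAVES-NE7b.md` (R-OWNER-40-2, `CLAIMS.log` l.26158; claim
l.26451), custodian lineage leaf-08; part 1 = `HistoryRealisePrintTimed` (p246807).

WHY.  The ENDs of the COUNT road read the live structures of the bad terms through the hypothesis shapes
`HistoryAssemblyRealiseLE.RealisedReading` (leaf-03, p210803) and `HistoryAssemblyRealiseRun.RealisedReadingR` (leaf-02
g2, per-run profile), whose geometric field `real` asks `Realises … ∧ PendingAt … K` — by the owner's located MODEL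
finding F-ne7bp1g40-1 one index STRONGER than print at joins and at the cutoff.  THIS FILE carries the PRINT-EXACT TWINS
of the two reading carriers — `real := ∃ Z, RealisesP … ∧ PendingBefore … K`, every other field token for token — and
re-derives the LE term reading from them through part 1 (`consistentTLE_genT_of_realisesP`,
`lt_reach_genT_of_pendingBefore`): the SAME `TermReadingLE …` conclusion, so every END over `TermReadingLE`
(`hybridNE7_of_termReadingLE_canon` and its run ∕ pinned ∕ headline descendants) re-plugs BY NAME (row S12-P).  The
landed carriers IMPLY the print-exact ones (`RealisedReading.toP`, `RealisedReadingR.toP`).  Append-only.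

WHAT.  §1 **`structure RealisedReadingP`**, `RealisedReading.toP`, **`termReadingLE_of_realisedP`**.  §2
**`structure RealisedReadingRP`** (profile per cutoff), `RealisedReadingR.toP`, `RealisedReadingRP.of_realisedReadingP`,
**`termReadingLE_of_realisedRP`**.  [folklore] two hypothesis SHAPES (twins of landed shapes; no `Prop` FACT of print
minted) + junction lemmas; nothing printed asserted, no `[cite:]`, zero `sorry`.

HONEST.  The reading H3^NE7b (that the live structures ARE print-exactly realised pending pedigrees with root cells), (B)
and the BetaPertH-flow facts stay DISPLAYED; by-name class of every `WALL-NE7b-P1.md` §2 binder UNCHANGED; headline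
p224237 UNCHANGED BY NAME until S12-P re-plugs; NE7b NOT proved; spine 0∕9.  HONEST DEPENDENCY (cell): continuum YM on
T⁴ ⇐ BetaPertH ∧ nine spine estimates (0/9 proved); BetaPertH ⇐ (D1) ∧ (D4) ∧ CAP+tail; G-an2-4 gates asym, D1 and
NE2/3/4.  This file changes none of it. -/

open Finset MeasureTheory
open Literature.MathematicalPhysics.QuantumFieldTheory.Balaban1983to89
open T4PersistenceDictionary T4PersistentHistoryCount T4BankedInduction T4PrintedShapeBanking
open T4WeightBudget T4GlobalDenominator T4LiveClassFibration T4LiveStructureGas T4LiveGasToTerms T4RecordPriceSeam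
open T4PartnerMultiplicity T4IndicatorShell T4MatchingAssembly T4MatchingClosure T4MatchingClosureSocket T4Continuum
open T4StabilitySocket T4BranchingRecordsGas T4TaggedShapeBanking T4CanonicalMenus T4RenewalChains
open Summit.QuantumFields.BalabanUV.T4Continuum.PlacementBatch
open Summit.QuantumFields.BalabanUV.T4Continuum.PlacementSkeleton
open Summit.QuantumFields.BalabanUV.T4Continuum.CountThresholdUniform
open Summit.QuantumFields.BalabanUV.T4Continuum.CountThresholdExit
open Summit.QuantumFields.BalabanUV.T4Continuum.CountSeamJunction
open Summit.QuantumFields.BalabanUV.T4Continuum.LateMergers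
open Summit.QuantumFields.BalabanUV.T4Continuum.HistoryFlow
open Summit.QuantumFields.BalabanUV.T4Continuum.HistoryRegeneration
open Summit.QuantumFields.BalabanUV.T4Continuum.HistoryTables
open Summit.QuantumFields.BalabanUV.T4Continuum.HistoryAssemblyTrees
open Summit.QuantumFields.BalabanUV.T4Continuum.HistoryAssemblyTerms
open Summit.QuantumFields.BalabanUV.T4Continuum.HistoryAssemblyPedigree
open Summit.QuantumFields.BalabanUV.T4Continuum.HistoryConstants
open Summit.QuantumFields.BalabanUV.T4Continuum.HistoryGen
open Literature.MathematicalPhysics.QuantumFieldTheory.Balaban1983to89.B13ScaleTransfer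
open Summit.QuantumFields.BalabanUV.T4Continuum.ZoneSkeleton
open Summit.QuantumFields.BalabanUV.T4Continuum.HistorySocketTH
open Summit.QuantumFields.BalabanUV.T4Continuum.HistoryCaps
open Summit.QuantumFields.BalabanUV.T4Continuum.HistoryAssemblyPrice
open Summit.QuantumFields.BalabanUV.T4Continuum.HistoryBankingLE
open Summit.QuantumFields.BalabanUV.T4Continuum.HistoryTreeShapeLE
open Summit.QuantumFields.BalabanUV.T4Continuum.HistoryExitLE
open Summit.QuantumFields.BalabanUV.T4Continuum.HistoryAssemblyTermsLE
open Summit.QuantumFields.BalabanUV.T4Continuum.HistoryRealise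
open Summit.QuantumFields.BalabanUV.T4Continuum.HistoryRealisePrint
open Summit.QuantumFields.BalabanUV.T4Continuum.HistoryAssemblyRealiseLE
open Summit.QuantumFields.BalabanUV.T4Continuum.HistoryAssemblyRealiseRun

namespace Summit.QuantumFields.BalabanUV.T4Continuum.HistoryRealisePrintReading

noncomputable section

/-! ## §1 The per-term reading, print-exact, constant profile -/

section Reading

variable {ι α π γ : Type*} [DecidableEq α] [DecidableEq π] [DecidableEq γ] {d : ℕ}

/-- **THE PER-TERM READING AS PRINT-EXACTLY REALISED PENDING PEDIGREES** (twin of leaf-03's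
`HistoryAssemblyRealiseLE.RealisedReading`, hypothesis SHAPE): for every cutoff `K ≥ K₀` and term `τ ∈ T K`, the encoding
facts `renew_step`∕`forest`∕`headOldest`; every live component's region history is `RealisesP`-realised (join partners
pending STRICTLY BEFORE the join scale) and pending STRICTLY BEFORE the cutoff `K` (`PendingBefore`); the root-cell facts
`cell_mem`∕`cell_inj` (displayed here; discharged from domains in part 3). [folklore] -/
structure RealisedReadingP (L : ℕ) (s : ℕ → ℕ) (Cell : ℕ → ℕ → Finset γ) (K₀ : ℕ) (R : ℕ → ℕ → ℕ) (T : ℕ → Finset ι)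
    (ped : ℕ → ι → Pedigree α π) (cellP : ℕ → ι → π → Pt d × Finset (Pt d)) (liveC : ℕ → ι → Finset α)
    (cellOf : ℕ → ι → α → γ) : Prop where
  /-- encoding: a renewal is dated one step after the renewed part -/
  renew_step : ∀ K, K₀ ≤ K → ∀ τ ∈ T K, ∀ c c', Part.old c' true ∈ (ped K τ).parts c →
    (ped K τ).step c' + 1 = (ped K τ).step c
  /-- the pedigree is a forest -/
  forest : ∀ K, K₀ ≤ K → ∀ τ ∈ T K, ∀ c, (ped K τ).Forest c
  /-- oldest line first at every component -/
  headOldest : ∀ K, K₀ ≤ K → ∀ τ ∈ T K, ∀ c, (ped K τ).HeadOldest c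
  /-- every live component is print-exactly realised and pending strictly before the cutoff -/
  real : ∀ K, K₀ ≤ K → ∀ τ ∈ T K, ∀ c ∈ liveC K τ, ∃ Z : Finset (Pt d),
    RealisesP L s (R K) ((ped K τ).toPGen (cellP K τ) c) Z ∧
      PendingBefore L s (R K) ((ped K τ).toPGen (cellP K τ) c).lastStep Z K
  /-- the root cell of a live component is a cell of the root's age -/
  cell_mem : ∀ K, K₀ ≤ K → ∀ τ ∈ T K, ∀ c ∈ liveC K τ, cellOf K τ c ∈ Cell K (K - ((ped K τ).genT c).rootStep)
  /-- distinct live components of one term have distinct root cells -/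
  cell_inj : ∀ K, K₀ ≤ K → ∀ τ ∈ T K, Set.InjOn (cellOf K τ) (liveC K τ : Set α)

variable {L : ℕ} {s : ℕ → ℕ} {C : T4PrintedShapeBanking.Consts} {Cell : ℕ → ℕ → Finset γ} {K₀ : ℕ}
  {R : ℕ → ℕ → ℕ} {T : ℕ → Finset ι} {ped : ℕ → ι → Pedigree α π} {cellP : ℕ → ι → π → Pt d × Finset (Pt d)}
  {liveC : ℕ → ι → Finset α} {cellOf : ℕ → ι → α → γ}

omit [DecidableEq π] [DecidableEq γ] in
/-- **THE LANDED READING IMPLIES THE PRINT-EXACT ONE** (`realisesP_of_realises`, `pendingBefore_of_pendingAt`).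
[folklore] -/
theorem RealisedReading.toP (H : RealisedReading L s Cell K₀ R T ped cellP liveC cellOf) :
    RealisedReadingP L s Cell K₀ R T ped cellP liveC cellOf where
  renew_step := H.renew_step
  forest := H.forest
  headOldest := H.headOldest
  real K hK τ hτ c hc := by
    obtain ⟨Z, hre, hpend⟩ := H.real K hK τ hτ c hc
    exact ⟨Z, realisesP_of_realises _ Z hre, pendingBefore_of_pendingAt hpend⟩
  cell_mem := H.cell_mem
  cell_inj := H.cell_inj

/-- **THE PRINT-EXACT READING GIVES THE LE TERM READING** for the member map `memOf`, caps `dcapOf`∕`ncapOf` read off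
the data, any matching scale, under row S1b's side conditions (`4 ≤ L`, drop control, `1 ≤ R K t`, `13 ≤ C.n₁`):
`consistent` by `consistentTLE_genT_of_realisesP`, `pending` by `lt_reach_genT_of_pendingBefore` (part 1), `wf` by
`wf_of_consistentTLE_freshT_chrono` with `freshT_genT`∕`chronoC_genT`, `chrono`, `fat_lt`∕`fuel_le`, `cell_mem`, `inj` as in
leaf-03's `termReadingLE_of_realised` — the SAME `TermReadingLE` conclusion. [folklore] -/
theorem termReadingLE_of_realisedP (hL : 4 ≤ L) (hdrop : ∀ m, B16SProfile.DropCtl s m) (hn₁ : 13 ≤ C.n₁)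
    (hR1 : ∀ K, K₀ ≤ K → ∀ t, 1 ≤ R K t) (H : RealisedReadingP L s Cell K₀ R T ped cellP liveC cellOf)
    (jstar : ℕ → ℕ) :
    TermReadingLE Prod.fst C Cell (dcapOf Prod.fst T (memOf ped liveC cellOf)) (ncapOf T (memOf ped liveC cellOf))
      jstar K₀ R T (memOf ped liveC cellOf) where
  consistent K hK τ hτ q hq := by
    obtain ⟨c, hc, rfl⟩ := mem_memOf.1 hq
    obtain ⟨Z, hre, hpend⟩ := H.real K hK τ (mem_badTerms.1 hτ).1 c hc
    exact consistentTLE_genT_of_realisesP hL hdrop (hR1 K hK) C hn₁ (ped K τ) (cellP K τ)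
      (H.renew_step K hK τ (mem_badTerms.1 hτ).1) hre hpend.1
  wf K hK τ hτ q hq := by
    obtain ⟨c, hc, rfl⟩ := mem_memOf.1 hq
    obtain ⟨Z, hre, hpend⟩ := H.real K hK τ (mem_badTerms.1 hτ).1 c hc
    exact wf_of_consistentTLE_freshT_chrono
      (consistentTLE_genT_of_realisesP hL hdrop (hR1 K hK) C hn₁ (ped K τ) (cellP K τ)
        (H.renew_step K hK τ (mem_badTerms.1 hτ).1) hre hpend.1)
      (Pedigree.freshT_genT (H.forest K hK τ (mem_badTerms.1 hτ).1) c)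
      (Pedigree.chronoC_genT (H.headOldest K hK τ (mem_badTerms.1 hτ).1) c)
  pending K hK τ hτ q hq := by
    obtain ⟨c, hc, rfl⟩ := mem_memOf.1 hq
    obtain ⟨Z, hre, hpend⟩ := H.real K hK τ (mem_badTerms.1 hτ).1 c hc
    exact lt_reach_genT_of_pendingBefore hL hdrop (hR1 K hK) C hn₁ (ped K τ) (cellP K τ)
      (H.renew_step K hK τ (mem_badTerms.1 hτ).1) hre hpend
  cell_mem K hK τ hτ q hq := by
    obtain ⟨c, hc, rfl⟩ := mem_memOf.1 hq
    exact H.cell_mem K hK τ (mem_badTerms.1 hτ).1 c hc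
  chrono K hK τ hτ q hq := by
    obtain ⟨c, -, rfl⟩ := mem_memOf.1 hq
    exact Pedigree.chronoC_genT (H.headOldest K hK τ (mem_badTerms.1 hτ).1) c
  fat_lt K hK τ hτ q hq e he hk :=
    fat_lt_of_mem Prod.fst T (memOf ped liveC cellOf) K₀ K hK τ (mem_badTerms.1 hτ).1 q hq e he hk
  fuel_le K hK τ hτ q hq := fuel_le_of_mem T (memOf ped liveC cellOf) K₀ K hK τ (mem_badTerms.1 hτ).1 q hq
  inj K hK τ hτ := by
    intro q hq q' hq' hs
    obtain ⟨c, hc, rfl⟩ := mem_memOf.1 (Finset.mem_coe.1 hq)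
    obtain ⟨c', hc', rfl⟩ := mem_memOf.1 (Finset.mem_coe.1 hq')
    have hcell : cellOf K τ c = cellOf K τ c' := by
      have := congrArg (fun s : BSlot γ PEv => s.2.1) hs
      simpa [bslotOf] using this
    have hcc : c = c' := H.cell_inj K hK τ (mem_badTerms.1 hτ).1 (Finset.mem_coe.2 hc) (Finset.mem_coe.2 hc') hcell
    subst hcc
    rfl

end Reading

/-! ## §2 The per-term reading, print-exact, profile per cutoff -/

section ReadingR

variable {ι α π γ : Type*} [DecidableEq α] [DecidableEq π] [DecidableEq γ] {d : ℕ}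

/-- **THE PER-TERM READING AS PRINT-EXACTLY REALISED PENDING PEDIGREES, PROFILE PER CUTOFF** (twin of leaf-02 g2's
`HistoryAssemblyRealiseRun.RealisedReadingR`, hypothesis SHAPE): as `RealisedReadingP` with blocking exponents `s K` of
the run with cutoff `K` in `real`. [folklore] -/
structure RealisedReadingRP (L : ℕ) (s : ℕ → ℕ → ℕ) (Cell : ℕ → ℕ → Finset γ) (K₀ : ℕ) (R : ℕ → ℕ → ℕ)
    (T : ℕ → Finset ι) (ped : ℕ → ι → Pedigree α π) (cellP : ℕ → ι → π → Pt d × Finset (Pt d))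
    (liveC : ℕ → ι → Finset α) (cellOf : ℕ → ι → α → γ) : Prop where
  /-- encoding: a renewal is dated one step after the renewed part -/
  renew_step : ∀ K, K₀ ≤ K → ∀ τ ∈ T K, ∀ c c', Part.old c' true ∈ (ped K τ).parts c →
    (ped K τ).step c' + 1 = (ped K τ).step c
  /-- the pedigree is a forest -/
  forest : ∀ K, K₀ ≤ K → ∀ τ ∈ T K, ∀ c, (ped K τ).Forest c
  /-- oldest line first at every component -/
  headOldest : ∀ K, K₀ ≤ K → ∀ τ ∈ T K, ∀ c, (ped K τ).HeadOldest c
  /-- every live component is print-exactly realised by the run's blockings and pending strictly before the cutoff -/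
  real : ∀ K, K₀ ≤ K → ∀ τ ∈ T K, ∀ c ∈ liveC K τ, ∃ Z : Finset (Pt d),
    RealisesP L (s K) (R K) ((ped K τ).toPGen (cellP K τ) c) Z ∧
      PendingBefore L (s K) (R K) ((ped K τ).toPGen (cellP K τ) c).lastStep Z K
  /-- the root cell of a live component is a cell of the root's age -/
  cell_mem : ∀ K, K₀ ≤ K → ∀ τ ∈ T K, ∀ c ∈ liveC K τ, cellOf K τ c ∈ Cell K (K - ((ped K τ).genT c).rootStep)
  /-- distinct live components of one term have distinct root cells -/
  cell_inj : ∀ K, K₀ ≤ K → ∀ τ ∈ T K, Set.InjOn (cellOf K τ) (liveC K τ : Set α)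

variable {L : ℕ} {Cell : ℕ → ℕ → Finset γ} {K₀ : ℕ} {R : ℕ → ℕ → ℕ} {T : ℕ → Finset ι}
  {ped : ℕ → ι → Pedigree α π} {cellP : ℕ → ι → π → Pt d × Finset (Pt d)} {liveC : ℕ → ι → Finset α}
  {cellOf : ℕ → ι → α → γ}

omit [DecidableEq π] [DecidableEq γ] in
/-- **THE LANDED PER-RUN READING IMPLIES THE PRINT-EXACT ONE.** [folklore] -/
theorem RealisedReadingR.toP {s : ℕ → ℕ → ℕ} (H : RealisedReadingR L s Cell K₀ R T ped cellP liveC cellOf) :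
    RealisedReadingRP L s Cell K₀ R T ped cellP liveC cellOf where
  renew_step := H.renew_step
  forest := H.forest
  headOldest := H.headOldest
  real K hK τ hτ c hc := by
    obtain ⟨Z, hre, hpend⟩ := H.real K hK τ hτ c hc
    exact ⟨Z, realisesP_of_realises _ Z hre, pendingBefore_of_pendingAt hpend⟩
  cell_mem := H.cell_mem
  cell_inj := H.cell_inj

omit [DecidableEq π] [DecidableEq γ] in
/-- a constant profile is a per-cutoff profile (print-exact form) [folklore] -/
theorem RealisedReadingRP.of_realisedReadingP {s : ℕ → ℕ}
    (H : RealisedReadingP L s Cell K₀ R T ped cellP liveC cellOf) :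
    RealisedReadingRP L (fun _ => s) Cell K₀ R T ped cellP liveC cellOf where
  renew_step := H.renew_step
  forest := H.forest
  headOldest := H.headOldest
  real := H.real
  cell_mem := H.cell_mem
  cell_inj := H.cell_inj

variable {s : ℕ → ℕ → ℕ} {C : T4PrintedShapeBanking.Consts}

/-- **THE PRINT-EXACT PER-CUTOFF READING GIVES THE LE TERM READING** under the side conditions `4 ≤ L`, drop control of
each profile `s K` (`K ≥ K₀`), `1 ≤ R K t`, `13 ≤ C.n₁` (twin of leaf-02 g2's `termReadingLE_of_realisedR`, part 1's
lemmas applied at each cutoff). [folklore] -/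
theorem termReadingLE_of_realisedRP (hL : 4 ≤ L) (hdrop : ∀ K, K₀ ≤ K → ∀ m, B16SProfile.DropCtl (s K) m)
    (hn₁ : 13 ≤ C.n₁) (hR1 : ∀ K, K₀ ≤ K → ∀ t, 1 ≤ R K t)
    (H : RealisedReadingRP L s Cell K₀ R T ped cellP liveC cellOf) (jstar : ℕ → ℕ) :
    TermReadingLE Prod.fst C Cell (dcapOf Prod.fst T (memOf ped liveC cellOf)) (ncapOf T (memOf ped liveC cellOf))
      jstar K₀ R T (memOf ped liveC cellOf) where
  consistent K hK τ hτ q hq := by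
    obtain ⟨c, hc, rfl⟩ := mem_memOf.1 hq
    obtain ⟨Z, hre, hpend⟩ := H.real K hK τ (mem_badTerms.1 hτ).1 c hc
    exact consistentTLE_genT_of_realisesP hL (hdrop K hK) (hR1 K hK) C hn₁ (ped K τ) (cellP K τ)
      (H.renew_step K hK τ (mem_badTerms.1 hτ).1) hre hpend.1
  wf K hK τ hτ q hq := by
    obtain ⟨c, hc, rfl⟩ := mem_memOf.1 hq
    obtain ⟨Z, hre, hpend⟩ := H.real K hK τ (mem_badTerms.1 hτ).1 c hc
    exact wf_of_consistentTLE_freshT_chrono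
      (consistentTLE_genT_of_realisesP hL (hdrop K hK) (hR1 K hK) C hn₁ (ped K τ) (cellP K τ)
        (H.renew_step K hK τ (mem_badTerms.1 hτ).1) hre hpend.1)
      (Pedigree.freshT_genT (H.forest K hK τ (mem_badTerms.1 hτ).1) c)
      (Pedigree.chronoC_genT (H.headOldest K hK τ (mem_badTerms.1 hτ).1) c)
  pending K hK τ hτ q hq := by
    obtain ⟨c, hc, rfl⟩ := mem_memOf.1 hq
    obtain ⟨Z, hre, hpend⟩ := H.real K hK τ (mem_badTerms.1 hτ).1 c hc
    exact lt_reach_genT_of_pendingBefore hL (hdrop K hK) (hR1 K hK) C hn₁ (ped K τ) (cellP K τ)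
      (H.renew_step K hK τ (mem_badTerms.1 hτ).1) hre hpend
  cell_mem K hK τ hτ q hq := by
    obtain ⟨c, hc, rfl⟩ := mem_memOf.1 hq
    exact H.cell_mem K hK τ (mem_badTerms.1 hτ).1 c hc
  chrono K hK τ hτ q hq := by
    obtain ⟨c, -, rfl⟩ := mem_memOf.1 hq
    exact Pedigree.chronoC_genT (H.headOldest K hK τ (mem_badTerms.1 hτ).1) c
  fat_lt K hK τ hτ q hq e he hk :=
    fat_lt_of_mem Prod.fst T (memOf ped liveC cellOf) K₀ K hK τ (mem_badTerms.1 hτ).1 q hq e he hk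
  fuel_le K hK τ hτ q hq := fuel_le_of_mem T (memOf ped liveC cellOf) K₀ K hK τ (mem_badTerms.1 hτ).1 q hq
  inj K hK τ hτ := by
    intro q hq q' hq' hs
    obtain ⟨c, hc, rfl⟩ := mem_memOf.1 (Finset.mem_coe.1 hq)
    obtain ⟨c', hc', rfl⟩ := mem_memOf.1 (Finset.mem_coe.1 hq')
    have hcell : cellOf K τ c = cellOf K τ c' := by
      have := congrArg (fun s : BSlot γ PEv => s.2.1) hs
      simpa [bslotOf] using this
    have hcc : c = c' := H.cell_inj K hK τ (mem_badTerms.1 hτ).1 (Finset.mem_coe.2 hc) (Finset.mem_coe.2 hc') hcell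
    subst hcc
    rfl

end ReadingR

end

end Summit.QuantumFields.BalabanUV.T4Continuum.HistoryRealisePrintReading
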